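import Mathlib
import Literature.Analysis.FluidPDE.SelfSimilarEulerProfileVorticity
import Literature.Analysis.FluidPDE.CommutingVelocityVorticityFlows
import Literature.Analysis.FluidPDE.AxisymQuotientBounds
import Literature.Analysis.FluidPDE.VorticityCalculus
import Summits.NavierStokesRegularity.NavierStokesRegularity.Theorems.EulerZoomLiouvillePowerGaugeEulerLiouvilleSelfSimilarBeltrami
import HarnessLib

/-!
# Crux `EulerZoomLiouville.PowerGaugeEulerLiouville` (stmt-NavierStokesRegularity-19832), THE ONE STATEMENT `stub_selfSimilarC2Needle`:
# THE VORTICITY OF A `C²` COLLAPSE PROFILE IS SOURCED ALONG RAYS BY THE COMMUTATOR `[V, curl V]` — no needle whose velocity and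
# vorticity commute (no STEADY-EULER needle, no generalized-Beltrami needle)

Helper file (theorems only; `--supports stmt-NavierStokesRegularity-19832`; def-free).  Hand leafhand-ns-eulerzoomliouville-10 g1, sequel of
`…SelfSimilarBeltrami` (force-free needles).

For a `C²` self-similar Euler profile `(U, P)` (CIV (3.3), exponent `γ > 0`, centre `0`) write `Ω = curl U` and
`[U, Ω] = (U·∇)Ω − (Ω·∇)U` (`convect U Ω − convect Ω U`, Kambe's commutator of the steady theory, tree file
`Literature/…/CommutingVelocityVorticityFlows`).  The vorticity form CIV (3.4) reads `Ω + γ (y·∇)Ω = −[U, Ω]`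
(`RaySource.smul_fderiv_curl_self_eq`): the linear EULER-HOMOGENEITY operator on the left has no non-zero solution continuous at the
origin (`Beltrami.eq_zero_of_add_smul_fderiv_self`), so the vorticity of a collapse profile is produced ENTIRELY by the commutator.
Quantitatively, integrating along rays (`0 < γ ≤ 1`, which contains every class rate `γ = 1/(2+ρ)`):

  `curl U (y) = −γ⁻¹ ∫₀¹ s^{1/γ − 1} [U, Ω](s y) ds`      (`RaySource.curl_eq_integral_commutator`).

Consequences (all without growth, decay, extremality or symmetry hypotheses):
* `RaySource.curl_eq_zero_of_convect_comm` — if `U` and `curl U` COMMUTE (`(U·∇)Ω = (Ω·∇)U` everywhere: the steady inviscid vorticity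
  balance, Kambe (8.104) ⇒ `[u, ω] = 0`), the profile is irrotational (every `γ > 0`);
* `RaySource.curl_eq_zero_of_cross_curl_eq_gradient` — GENERALIZED BELTRAMI needles (`U × curl U = ∇B`, `B ∈ C²`; contains the force-free
  case `U × curl U = 0` of `…SelfSimilarBeltrami` and every profile that is itself a steady Euler velocity field) are irrotational
  (Lamb form `(U·∇)U = Ω × U + ∇½|U|²`, tree `convect_self_eq_cross_curl_add_gradient`, and `curl_convect_self_of_isDivFree`);
* `RaySource.curl_eq_zero_of_isSteadyClassicalNS` — a profile that is ALSO a steady classical Euler field (for some pressure) is irrotational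
  (tree `CommutingFlows.convect_curl_comm_of_steadyEuler`);
* `RaySource.curl_eq_zero_of_convect_comm_on_ball` — LOCAL version: if the commutator vanishes on a ball about the origin, so does the
  vorticity there (rays from the origin stay in the ball);
* member level `Loc.selfSimilar_ae_eq_zero_of_commutingC2_profile` / `…_of_lambGradientC2_profile` / `…_of_steadyEulerC2_profile` and, in the
  skeleton's binder language, `Birth.selfSimilarC2Needle_of_commuting`: such members of the class are trivial (irrotational endgame
  `Loc.selfSimilar_ae_eq_zero_of_irrotationalC2_profile` under the `A`-gauge).

WHAT THIS IS NOT: not a proof of the stub, the crux, or the route; nothing about Navier–Stokes; the generic needle has `[V, curl V] ≠ 0`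
somewhere on every ray segment carrying vorticity — that is the content left open.  [folklore; ConstantinIgnatovaVicol2026Putative §3.1.1
(3.3)–(3.4); Kambe2004 §8.8.1 (8.104)–(8.105) (`[u, ω] = 0` for steady flows)]
-/

noncomputable section

-- flat `Theorems/<Route><Decl>…` files of one crux share the namespace of the crux (tree convention)
set_option linter.dupNamespace false

open MeasureTheory Set Filter Topology Metric Function intervalIntegral
open scoped RealInnerProductSpace NNReal ENNReal ContDiff

namespace Summit.NavierStokesRegularity.NavierStokesRegularity.Theorems.PowerGaugeEulerLiouville

open Literature.Analysis Literature.Analysis.FluidPDE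

namespace RaySource

variable {γ : ℝ} {U : EuclideanSpace ℝ (Fin 3) → EuclideanSpace ℝ (Fin 3)} {P : EuclideanSpace ℝ (Fin 3) → ℝ}

/-! ### The vorticity equation as an Euler-homogeneity equation with source `−[U, Ω]` -/

/-- **CIV (3.4) rearranged**: for a `C²` profile, `γ DΩ(y)[y] = −Ω(y) − [U, Ω](y)` with `Ω = curl U` and
`[U, Ω] = (U·∇)Ω − (Ω·∇)U = convect U Ω − convect Ω U`. [folklore; ConstantinIgnatovaVicol2026Putative §3.1.1 (3.4)] -/
theorem smul_fderiv_curl_self_eq (hprof : IsSelfSimilarEulerProfile γ 0 U P) (y : EuclideanSpace ℝ (Fin 3)) :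
    γ • fderiv ℝ (curl U) y y = -(curl U y) - (convect U (curl U) y - convect (curl U) U y) := by
  have hv := hprof.isSelfSimilarEulerVorticityProfile.vorticity_eq y
  rw [sub_zero, map_add, map_smul] at hv
  simp only [convect_apply]
  have : γ • fderiv ℝ (curl U) y y = fderiv ℝ U y (curl U y) - curl U y - fderiv ℝ (curl U) y (U y) := by
    rw [← hv]; abel
  rw [this]; abel

/-- **NO COMMUTING NEEDLE** (every `γ > 0`): if the velocity and the vorticity of a `C²` self-similar Euler profile commute,
`(U·∇)(curl U) = ((curl U)·∇)U` everywhere (the steady inviscid vorticity balance), then `curl U ≡ 0` — CIV (3.4) collapses to the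
Euler-homogeneity equation `Ω + γ DΩ[y] = 0`, killed by `Beltrami.eq_zero_of_add_smul_fderiv_self`. [folklore] -/
theorem curl_eq_zero_of_convect_comm (hprof : IsSelfSimilarEulerProfile γ 0 U P) (hγ : 0 < γ)
    (hcomm : ∀ x, convect U (curl U) x = convect (curl U) U x) : ∀ y, curl U y = 0 := by
  have hkey : ∀ y, curl U y + γ • fderiv ℝ (curl U) y y = 0 := by
    intro y
    rw [smul_fderiv_curl_self_eq hprof y, hcomm y, sub_self, sub_zero, add_neg_cancel]
  have hzero := Beltrami.eq_zero_of_add_smul_fderiv_self (differentiable_curl_of_contDiff hprof.contDiff_velocity) hγ hkey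
  exact fun y => congrFun hzero y

/-- **NO GENERALIZED-BELTRAMI NEEDLE** (every `γ > 0`): if the Lamb vector of a `C²` self-similar Euler profile is a gradient,
`U × curl U = ∇B` with `B ∈ C²`, then `curl U ≡ 0`.  By the Lamb form `(U·∇)U = (curl U) × U + ∇(½|U|²)` the convective term is the
gradient `∇(½|U|² − B)`, so its curl — which is `[U, curl U]` for `div U = 0` — vanishes, and `curl_eq_zero_of_convect_comm` applies.
(Force-free profiles `U × curl U = 0` are the case `B = 0`; profiles that are steady Euler fields are the case `B = p + ½|U|²`.) [folklore;
Kambe2004 §8.8.1 (8.105)] -/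
theorem curl_eq_zero_of_cross_curl_eq_gradient (hprof : IsSelfSimilarEulerProfile γ 0 U P) (hγ : 0 < γ)
    {B : EuclideanSpace ℝ (Fin 3) → ℝ} (hB : ContDiff ℝ 2 B) (hlamb : ∀ x, cross (U x) (curl U x) = gradient B x) :
    ∀ y, curl U y = 0 := by
  have hU2 : ContDiff ℝ 2 U := hprof.contDiff_velocity
  have hUd : Differentiable ℝ U := hprof.differentiable_velocity
  -- `v × w = −(w × v)` (Mathlib's `cross_anticomm`, transported to `EuclideanSpace`)
  have hswap : ∀ v w : EuclideanSpace ℝ (Fin 3), cross v w = -cross w v := fun v w => by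
    simp only [cross]
    rw [← cross_anticomm, WithLp.toLp_neg]
  -- the kinetic potential `q = ½|U|²` is `C²`, and `C²` scalars have differentiable gradients
  set q : EuclideanSpace ℝ (Fin 3) → ℝ := fun z => ‖U z‖ ^ 2 / 2 with hq
  have hq2 : ContDiff ℝ 2 q := (hU2.norm_sq ℝ).div_const 2
  have hdgrad : ∀ {f : EuclideanSpace ℝ (Fin 3) → ℝ}, ContDiff ℝ 2 f → Differentiable ℝ (gradient f) := by
    intro f hf
    have hd : Differentiable ℝ (fderiv ℝ f) := (hf.fderiv_right (m := 1) (by norm_num)).differentiable (by simp)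
    exact (InnerProductSpace.toDual ℝ (EuclideanSpace ℝ (Fin 3))).symm.differentiable.comp hd
  -- the convective term is a gradient
  have hconv : convect U U = gradient q - gradient B := by
    funext x
    rw [Pi.sub_apply, convect_self_eq_cross_curl_add_gradient (hUd x), hswap, hlamb x]
    abel
  -- hence `[U, curl U] = curl ((U·∇)U) = 0`
  have hcomm : ∀ x, convect U (curl U) x = convect (curl U) U x := by
    intro x
    have h1 : curl (convect U U) x = 0 := by
      rw [hconv, curl_sub_apply (hdgrad hq2 x) (hdgrad hB x), curl_gradient_eq_zero_holds q hq2 x,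
        curl_gradient_eq_zero_holds B hB x, sub_zero]
    have h2 := curl_convect_self_of_isDivFree hU2 hprof.divFree x
    rw [h1] at h2
    exact sub_eq_zero.1 h2.symm
  exact curl_eq_zero_of_convect_comm hprof hγ hcomm

/-- **NO STEADY-EULER NEEDLE** (every `γ > 0`): a `C²` self-similar Euler collapse profile which is ALSO a steady classical Euler velocity
field on `ℝ³` (`IsSteadyClassicalNS 0 0 U q` for some pressure `q`) is irrotational — steady Euler flows have commuting velocity and
vorticity (Kambe (8.104), tree `CommutingFlows.convect_curl_comm_of_steadyEuler`). [folklore; Kambe2004 §8.8.1 (8.104)] -/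
theorem curl_eq_zero_of_isSteadyClassicalNS (hprof : IsSelfSimilarEulerProfile γ 0 U P) (hγ : 0 < γ)
    {q : EuclideanSpace ℝ (Fin 3) → ℝ} (hst : IsSteadyClassicalNS 0 0 U q) : ∀ y, curl U y = 0 :=
  curl_eq_zero_of_convect_comm hprof hγ (CommutingFlows.convect_curl_comm_of_steadyEuler hst)

/-! ### The ray representation of the vorticity -/

/-- **RAY REPRESENTATION OF THE VORTICITY OF A COLLAPSE PROFILE** (`0 < γ ≤ 1`): for every `y`,
`curl U (y) = −γ⁻¹ ∫₀¹ s^{1/γ−1} [U, curl U](s y) ds`, `[U, Ω] = convect U Ω − convect Ω U`.  Proof: along the ray,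
`g(s) = s^{1/γ} Ω(sy)` has `g'(s) = γ⁻¹ s^{1/γ−1}(Ω + γ DΩ[·])(sy) = −γ⁻¹ s^{1/γ−1}[U, Ω](sy)` (CIV (3.4)), `g(0) = 0`, `g(1) = Ω(y)`,
and the fundamental theorem of calculus on `[0,1]` applies (`1/γ − 1 ≥ 0`: the integrand is continuous). [folklore] -/
theorem curl_eq_integral_commutator (hprof : IsSelfSimilarEulerProfile γ 0 U P) (hγ : 0 < γ) (hγ1 : γ ≤ 1)
    (y : EuclideanSpace ℝ (Fin 3)) :
    curl U y = -(γ⁻¹ • ∫ s in (0:ℝ)..1,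
      (s ^ (1 / γ - 1)) • (convect U (curl U) (s • y) - convect (curl U) U (s • y))) := by
  have hγ0 : γ ≠ 0 := hγ.ne'
  have hU2 : ContDiff ℝ 2 U := hprof.contDiff_velocity
  have hΩd : Differentiable ℝ (curl U) := differentiable_curl_of_contDiff hU2
  have hΩ1 : ContDiff ℝ 1 (curl U) := contDiff_curl_of_succ (n := 1) (by exact_mod_cast hU2)
  -- the commutator is continuous
  set C : EuclideanSpace ℝ (Fin 3) → EuclideanSpace ℝ (Fin 3) :=
    fun z => convect U (curl U) z - convect (curl U) U z with hC
  have hCc : Continuous C := by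
    have h1 : Continuous fun z => fderiv ℝ (curl U) z (U z) :=
      (hΩ1.continuous_fderiv one_ne_zero).clm_apply hU2.continuous
    have h2 : Continuous fun z => fderiv ℝ U z (curl U z) :=
      (hU2.continuous_fderiv (by norm_num)).clm_apply hΩd.continuous
    simpa [hC, convect_apply, Pi.sub_def] using h1.sub h2
  -- exponent bookkeeping
  set p : ℝ := 1 / γ with hp
  have hp1 : 1 ≤ p := by rw [hp, le_div_iff₀ hγ, one_mul]; exact hγ1
  have hp0 : 0 < p := lt_of_lt_of_le one_pos hp1
  have hpγ : p = γ⁻¹ := one_div γ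
  -- the ray function and its derivative
  set g : ℝ → EuclideanSpace ℝ (Fin 3) := fun s => (s ^ p) • curl U (s • y) with hg
  set g' : ℝ → EuclideanSpace ℝ (Fin 3) := fun s => -(γ⁻¹ • ((s ^ (p - 1)) • C (s • y))) with hg'
  have hcont : ContinuousOn g (Icc 0 1) :=
    ((Real.continuous_rpow_const hp0.le).smul
      (hΩd.continuous.comp (continuous_id.smul continuous_const))).continuousOn
  have hg'c : Continuous g' :=
    (((Real.continuous_rpow_const (by linarith)).smul
      (hCc.comp (continuous_id.smul continuous_const))).const_smul γ⁻¹).neg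
  have hint : IntervalIntegrable g' volume 0 1 := hg'c.intervalIntegrable 0 1
  have hderiv : ∀ s ∈ Ioo (0:ℝ) 1, HasDerivAt g (g' s) s := by
    intro s hs
    have hs0 : 0 < s := hs.1
    have h1 : HasDerivAt (fun s : ℝ => s ^ p) (p * s ^ (p - 1)) s := Real.hasDerivAt_rpow_const (Or.inl hs0.ne')
    have hline : HasDerivAt (fun r : ℝ => r • y) ((1:ℝ) • y) s := (hasDerivAt_id' s).smul_const y
    have h2' := (hΩd (s • y)).hasFDerivAt.comp_hasDerivAt s hline
    rw [one_smul] at h2'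
    have h2 : HasDerivAt (fun s : ℝ => curl U (s • y)) (fderiv ℝ (curl U) (s • y) y) s := h2'
    have h12 := h1.smul h2
    -- the value of the derivative via CIV (3.4) at `s • y`
    have hsy : s • fderiv ℝ (curl U) (s • y) y = γ⁻¹ • (-(curl U (s • y)) - C (s • y)) := by
      have hk := smul_fderiv_curl_self_eq hprof (s • y)
      rw [map_smul] at hk
      calc s • fderiv ℝ (curl U) (s • y) y = γ⁻¹ • (γ • s • fderiv ℝ (curl U) (s • y) y) := by
            rw [smul_smul γ⁻¹ γ, inv_mul_cancel₀ hγ0, one_smul]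
        _ = γ⁻¹ • (-(curl U (s • y)) - C (s • y)) := by rw [hk]
    have hpow : s ^ p = s ^ (p - 1) * s := by
      rw [Real.rpow_sub_one hs0.ne', div_mul_cancel₀ _ hs0.ne']
    have hval : s ^ p • fderiv ℝ (curl U) (s • y) y + (p * s ^ (p - 1)) • curl U (s • y) = g' s := by
      rw [hg', hpow, mul_smul, hsy, hpγ]
      module
    exact h12.congr_deriv hval
  -- fundamental theorem of calculus on `[0, 1]`
  have hftc := integral_eq_sub_of_hasDerivAt_of_le zero_le_one hcont hderiv hint
  have hg1 : g 1 = curl U y := by simp [hg]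
  have hg0 : g 0 = 0 := by simp [hg, Real.zero_rpow hp0.ne']
  rw [hg1, hg0, sub_zero] at hftc
  rw [← hftc, hg']
  simp only [intervalIntegral.integral_neg, intervalIntegral.integral_smul, hp, hC]

/-- **LOCAL VERSION: irrotationality propagates along rays from the origin** (`0 < γ ≤ 1`): if the commutator `[U, curl U]` vanishes on
the ball `B(0, R)`, then `curl U = 0` on `B(0, R)`. [folklore] -/
theorem curl_eq_zero_of_convect_comm_on_ball (hprof : IsSelfSimilarEulerProfile γ 0 U P) (hγ : 0 < γ) (hγ1 : γ ≤ 1) {R : ℝ}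
    (hcomm : ∀ x ∈ ball (0 : EuclideanSpace ℝ (Fin 3)) R, convect U (curl U) x = convect (curl U) U x)
    {y : EuclideanSpace ℝ (Fin 3)} (hy : y ∈ ball (0 : EuclideanSpace ℝ (Fin 3)) R) : curl U y = 0 := by
  rw [curl_eq_integral_commutator hprof hγ hγ1 y]
  have hzero : ∫ s in (0:ℝ)..1, (s ^ (1 / γ - 1)) • (convect U (curl U) (s • y) - convect (curl U) U (s • y)) = 0 := by
    apply integral_zero_ae
    refine Filter.Eventually.of_forall fun s hs => ?_
    have hs' : s ∈ Icc (0:ℝ) 1 := by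
      rw [uIoc_of_le zero_le_one] at hs
      exact ⟨hs.1.le, hs.2⟩
    have hsy : s • y ∈ ball (0 : EuclideanSpace ℝ (Fin 3)) R := by
      rw [mem_ball_zero_iff] at hy ⊢
      calc ‖s • y‖ = |s| * ‖y‖ := norm_smul s y
        _ ≤ 1 * ‖y‖ := by
            gcongr
            rw [abs_le]; exact ⟨by linarith [hs'.1], hs'.2⟩
        _ < R := by rw [one_mul]; exact hy
    rw [hcomm (s • y) hsy, sub_self, smul_zero]
  rw [hzero, smul_zero, neg_zero]

end RaySource

/-! ### Member level -/

section Member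

variable {ρ : ℝ} {u : ℝ → EuclideanSpace ℝ (Fin 3) → EuclideanSpace ℝ (Fin 3)} {p : ℝ → EuclideanSpace ℝ (Fin 3) → ℝ} {c : ℝ≥0}
  {V : EuclideanSpace ℝ (Fin 3) → EuclideanSpace ℝ (Fin 3)} {P : EuclideanSpace ℝ (Fin 3) → ℝ}

/-- **EXACTLY SELF-SIMILAR MEMBERS WHOSE `C²` PROFILE HAS COMMUTING VELOCITY AND VORTICITY ARE TRIVIAL** (every `ρ > 0`): distributional
Euler pair on `(−∞,0) × ℝ³` + `A`-gauge + exact self-similarity about the origin + `V ∈ C²` + `(V·∇)curl V = (curl V·∇)V` ⇒ `u = 0` a.e.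
(classical pressure `Past.exists_isSelfSimilarEulerProfile`, `RaySource.curl_eq_zero_of_convect_comm`, irrotational endgame). [folklore] -/
theorem Loc.selfSimilar_ae_eq_zero_of_commutingC2_profile (hρ : 0 < ρ)
    (hsol : IsDistributionalNSSolutionOn (slab (EuclideanSpace ℝ (Fin 3)) (Iio 0) isOpen_Iio) 0 0 u p)
    (hA : ∀ a : ℝ, 0 < a → ENNReal.ofReal (a ^ (2 * ρ)) *
      cknA a (0 : ℝ × EuclideanSpace ℝ (Fin 3)) u ≤ (c : ℝ≥0∞))
    (hu : ∀ τ : ℝ, τ < 0 → u τ = selfSimilarCollapse (1 / (2 + ρ)) 0 V τ)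
    (hp : ∀ τ : ℝ, τ < 0 → p τ = selfSimilarCollapsePressure (1 / (2 + ρ)) 0 P τ)
    (hV : ContDiff ℝ 2 V) (hcomm : ∀ x, convect V (curl V) x = convect (curl V) V x) :
    uncurry u =ᵐ[volume.restrict (Iio (0 : ℝ) ×ˢ (univ : Set (EuclideanSpace ℝ (Fin 3))))] 0 := by
  have h2ρ : (0 : ℝ) < 2 + ρ := by linarith
  have hγ : (0 : ℝ) < 1 / (2 + ρ) := one_div_pos.2 h2ρ
  have hu' : ∀ τ : ℝ, τ < 0 → u τ = fun x => selfSimilarCollapse (1 / (2 + ρ)) 0 V τ (x - 0) :=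
    fun τ hτ => by rw [hu τ hτ]; funext x; rw [sub_zero]
  have hp' : ∀ τ : ℝ, τ < 0 → p τ = fun x => selfSimilarCollapsePressure (1 / (2 + ρ)) 0 P τ (x - 0) :=
    fun τ hτ => by rw [hp τ hτ]; funext x; rw [sub_zero]
  obtain ⟨P', hprof⟩ := Past.exists_isSelfSimilarEulerProfile (T := 0) (T₁ := 0) (x₀ := 0) hρ le_rfl le_rfl hsol hu' hp' hV
  have hcurl : ∀ y, curl V y = 0 := RaySource.curl_eq_zero_of_convect_comm hprof hγ hcomm
  exact Loc.selfSimilar_ae_eq_zero_of_irrotationalC2_profile hρ hsol hA hu hV hcurl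

/-- **EXACTLY SELF-SIMILAR MEMBERS WITH A GENERALIZED-BELTRAMI `C²` PROFILE (`V × curl V = ∇B`, `B ∈ C²`) ARE TRIVIAL** (every `ρ > 0`).
[folklore] -/
theorem Loc.selfSimilar_ae_eq_zero_of_lambGradientC2_profile (hρ : 0 < ρ)
    (hsol : IsDistributionalNSSolutionOn (slab (EuclideanSpace ℝ (Fin 3)) (Iio 0) isOpen_Iio) 0 0 u p)
    (hA : ∀ a : ℝ, 0 < a → ENNReal.ofReal (a ^ (2 * ρ)) *
      cknA a (0 : ℝ × EuclideanSpace ℝ (Fin 3)) u ≤ (c : ℝ≥0∞))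
    (hu : ∀ τ : ℝ, τ < 0 → u τ = selfSimilarCollapse (1 / (2 + ρ)) 0 V τ)
    (hp : ∀ τ : ℝ, τ < 0 → p τ = selfSimilarCollapsePressure (1 / (2 + ρ)) 0 P τ)
    (hV : ContDiff ℝ 2 V) {B : EuclideanSpace ℝ (Fin 3) → ℝ} (hB : ContDiff ℝ 2 B)
    (hlamb : ∀ x, cross (V x) (curl V x) = gradient B x) :
    uncurry u =ᵐ[volume.restrict (Iio (0 : ℝ) ×ˢ (univ : Set (EuclideanSpace ℝ (Fin 3))))] 0 := by
  have h2ρ : (0 : ℝ) < 2 + ρ := by linarith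
  have hγ : (0 : ℝ) < 1 / (2 + ρ) := one_div_pos.2 h2ρ
  have hu' : ∀ τ : ℝ, τ < 0 → u τ = fun x => selfSimilarCollapse (1 / (2 + ρ)) 0 V τ (x - 0) :=
    fun τ hτ => by rw [hu τ hτ]; funext x; rw [sub_zero]
  have hp' : ∀ τ : ℝ, τ < 0 → p τ = fun x => selfSimilarCollapsePressure (1 / (2 + ρ)) 0 P τ (x - 0) :=
    fun τ hτ => by rw [hp τ hτ]; funext x; rw [sub_zero]
  obtain ⟨P', hprof⟩ := Past.exists_isSelfSimilarEulerProfile (T := 0) (T₁ := 0) (x₀ := 0) hρ le_rfl le_rfl hsol hu' hp' hV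
  have hcurl : ∀ y, curl V y = 0 := RaySource.curl_eq_zero_of_cross_curl_eq_gradient hprof hγ hB hlamb
  exact Loc.selfSimilar_ae_eq_zero_of_irrotationalC2_profile hρ hsol hA hu hV hcurl

/-- **EXACTLY SELF-SIMILAR MEMBERS WHOSE `C²` PROFILE IS ITSELF A STEADY CLASSICAL EULER FIELD ARE TRIVIAL** (every `ρ > 0`). [folklore] -/
theorem Loc.selfSimilar_ae_eq_zero_of_steadyEulerC2_profile (hρ : 0 < ρ)
    (hsol : IsDistributionalNSSolutionOn (slab (EuclideanSpace ℝ (Fin 3)) (Iio 0) isOpen_Iio) 0 0 u p)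
    (hA : ∀ a : ℝ, 0 < a → ENNReal.ofReal (a ^ (2 * ρ)) *
      cknA a (0 : ℝ × EuclideanSpace ℝ (Fin 3)) u ≤ (c : ℝ≥0∞))
    (hu : ∀ τ : ℝ, τ < 0 → u τ = selfSimilarCollapse (1 / (2 + ρ)) 0 V τ)
    (hp : ∀ τ : ℝ, τ < 0 → p τ = selfSimilarCollapsePressure (1 / (2 + ρ)) 0 P τ)
    (hV : ContDiff ℝ 2 V) {q : EuclideanSpace ℝ (Fin 3) → ℝ} (hst : IsSteadyClassicalNS 0 0 V q) :
    uncurry u =ᵐ[volume.restrict (Iio (0 : ℝ) ×ˢ (univ : Set (EuclideanSpace ℝ (Fin 3))))] 0 :=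
  Loc.selfSimilar_ae_eq_zero_of_commutingC2_profile hρ hsol hA hu hp hV
    (CommutingFlows.convect_curl_comm_of_steadyEuler hst)

end Member

/-- **THE COMMUTING SUB-STRATUM OF `stub_selfSimilarC2Needle` IS CLOSED** (binder language of the skeleton of record, every `0 < ρ`): a class
member (`Birth.InClass`), exactly self-similar about the origin (`Birth.IsExactlySelfSimilar`) with `V ∈ C²` whose velocity and vorticity
commute, `(V·∇)curl V = (curl V·∇)V` — in particular every generalized-Beltrami profile `V × curl V = ∇B` and every profile that is a steady
classical Euler field — is trivial. [folklore] -/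
theorem Birth.selfSimilarC2Needle_of_commuting :
    ∀ ρ : ℝ, 0 < ρ →
      ∀ (u : ℝ → EuclideanSpace ℝ (Fin 3) → EuclideanSpace ℝ (Fin 3)) (p : ℝ → EuclideanSpace ℝ (Fin 3) → ℝ)
        (H : ℝ → EuclideanSpace ℝ (Fin 3) → EuclideanSpace ℝ (Fin 3) →L[ℝ] EuclideanSpace ℝ (Fin 3)) (c : ℝ≥0)
        (V : EuclideanSpace ℝ (Fin 3) → EuclideanSpace ℝ (Fin 3)) (P : EuclideanSpace ℝ (Fin 3) → ℝ),
        Birth.InClass ρ u p H c → Birth.IsExactlySelfSimilar ρ u p V P → ContDiff ℝ 2 V →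
          (∀ x, convect V (curl V) x = convect (curl V) V x) →
          uncurry u =ᵐ[volume.restrict (Iio (0 : ℝ) ×ˢ (univ : Set (EuclideanSpace ℝ (Fin 3))))] 0 := by
  intro ρ hρ u p H c V P hcl hss hV hcomm
  obtain ⟨hsw, -, hgauge⟩ := hcl
  have hA : ∀ a : ℝ, 0 < a → ENNReal.ofReal (a ^ (2 * ρ)) *
      cknA a (0 : ℝ × EuclideanSpace ℝ (Fin 3)) u ≤ (c : ℝ≥0∞) :=
    fun a ha => le_trans (le_trans le_self_add le_self_add) (hgauge a ha)
  exact Loc.selfSimilar_ae_eq_zero_of_commutingC2_profile hρ hsw.distributional hA hss.1 hss.2 hV hcomm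

/-- **THE GENERALIZED-BELTRAMI SUB-STRATUM OF `stub_selfSimilarC2Needle` IS CLOSED** (binder language, every `0 < ρ`): `V × curl V = ∇B` with
`B ∈ C²` ⇒ trivial. [folklore] -/
theorem Birth.selfSimilarC2Needle_of_lambGradient :
    ∀ ρ : ℝ, 0 < ρ →
      ∀ (u : ℝ → EuclideanSpace ℝ (Fin 3) → EuclideanSpace ℝ (Fin 3)) (p : ℝ → EuclideanSpace ℝ (Fin 3) → ℝ)
        (H : ℝ → EuclideanSpace ℝ (Fin 3) → EuclideanSpace ℝ (Fin 3) →L[ℝ] EuclideanSpace ℝ (Fin 3)) (c : ℝ≥0)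
        (V : EuclideanSpace ℝ (Fin 3) → EuclideanSpace ℝ (Fin 3)) (P : EuclideanSpace ℝ (Fin 3) → ℝ),
        Birth.InClass ρ u p H c → Birth.IsExactlySelfSimilar ρ u p V P → ContDiff ℝ 2 V →
          (∃ B : EuclideanSpace ℝ (Fin 3) → ℝ, ContDiff ℝ 2 B ∧ ∀ x, cross (V x) (curl V x) = gradient B x) →
          uncurry u =ᵐ[volume.restrict (Iio (0 : ℝ) ×ˢ (univ : Set (EuclideanSpace ℝ (Fin 3))))] 0 := by
  intro ρ hρ u p H c V P hcl hss hV hB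
  obtain ⟨hsw, -, hgauge⟩ := hcl
  obtain ⟨B, hB, hlamb⟩ := hB
  have hA : ∀ a : ℝ, 0 < a → ENNReal.ofReal (a ^ (2 * ρ)) *
      cknA a (0 : ℝ × EuclideanSpace ℝ (Fin 3)) u ≤ (c : ℝ≥0∞) :=
    fun a ha => le_trans (le_trans le_self_add le_self_add) (hgauge a ha)
  exact Loc.selfSimilar_ae_eq_zero_of_lambGradientC2_profile hρ hsw.distributional hA hss.1 hss.2 hV hB hlamb

/-! ### Pointwise force-free profiles (no global proportionality factor) -/

/-- **NO FORCE-FREE NEEDLE, pointwise form** (every `γ > 0`): a `C²` self-similar Euler profile with `V × curl V = 0` everywhere is irrotational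
(the case `B = 0` of `RaySource.curl_eq_zero_of_cross_curl_eq_gradient`; no proportionality factor `λ` is needed, unlike
`Beltrami.curl_eq_zero_of_curl_eq_smul`). [folklore] -/
theorem RaySource.curl_eq_zero_of_cross_curl_eq_zero {γ : ℝ} {U : EuclideanSpace ℝ (Fin 3) → EuclideanSpace ℝ (Fin 3)}
    {P : EuclideanSpace ℝ (Fin 3) → ℝ} (hprof : IsSelfSimilarEulerProfile γ 0 U P) (hγ : 0 < γ)
    (hff : ∀ x, cross (U x) (curl U x) = 0) : ∀ y, curl U y = 0 :=
  RaySource.curl_eq_zero_of_cross_curl_eq_gradient hprof hγ (B := fun _ => (0 : ℝ)) contDiff_const fun x => by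
    rw [hff x]
    simp [gradient]

/-- **THE POINTWISE FORCE-FREE SUB-STRATUM OF `stub_selfSimilarC2Needle` IS CLOSED** (binder language, every `0 < ρ`): a class member, exactly
self-similar about the origin, with `C²` profile satisfying `V × curl V = 0` pointwise, is trivial. [folklore] -/
theorem Birth.selfSimilarC2Needle_of_forceFree :
    ∀ ρ : ℝ, 0 < ρ →
      ∀ (u : ℝ → EuclideanSpace ℝ (Fin 3) → EuclideanSpace ℝ (Fin 3)) (p : ℝ → EuclideanSpace ℝ (Fin 3) → ℝ)
        (H : ℝ → EuclideanSpace ℝ (Fin 3) → EuclideanSpace ℝ (Fin 3) →L[ℝ] EuclideanSpace ℝ (Fin 3)) (c : ℝ≥0)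
        (V : EuclideanSpace ℝ (Fin 3) → EuclideanSpace ℝ (Fin 3)) (P : EuclideanSpace ℝ (Fin 3) → ℝ),
        Birth.InClass ρ u p H c → Birth.IsExactlySelfSimilar ρ u p V P → ContDiff ℝ 2 V →
          (∀ x, cross (V x) (curl V x) = 0) →
          uncurry u =ᵐ[volume.restrict (Iio (0 : ℝ) ×ˢ (univ : Set (EuclideanSpace ℝ (Fin 3))))] 0 := by
  intro ρ hρ u p H c V P hcl hss hV hff
  refine Birth.selfSimilarC2Needle_of_lambGradient ρ hρ u p H c V P hcl hss hV ⟨fun _ => (0 : ℝ), contDiff_const, fun x => ?_⟩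
  rw [hff x]
  simp [gradient]

end Summit.NavierStokesRegularity.NavierStokesRegularity.Theorems.PowerGaugeEulerLiouville

end
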